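import Summits.PneNP.PneNP.Theses.KarlinRubin
import Summits.PneNP.PneNP.Theorems.KarlinRubinMonotoneBlindDnfBlind
import Summits.PneNP.PneNP.Theorems.KarlinRubinMonotoneSufficesStubThresholdSharp

/-!
# Crux `MonotoneBlind` (stmt-PneNP-18027, route KarlinRubin), line `Sketch`: stub `stub_thresholdWeakBlind`

**Edge-count thresholds are weakly blind** (calibration of the dead–revival framework of line `Sketch`, barrier
note B3 "thresholds are native"). For `0 < δ < 1/2` and ANY threshold sequence `θ : ℕ → ℕ`, the monotone test
`[θ n ≤ #{e | x e}]` on the edge slots of `Kₙ` satisfies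

  `Pr_{G(n,1/2,⌈n^{1/2-δ}⌉)}[θ n ≤ #on] ≤ Pr_{G(n,1/2)}[θ n ≤ #on] + ε n` eventually, `ε n = 8 n^{-2δ} → 0`,

not because it has few minimal completions near the threshold (it has `N^{Θ(1)}`) but because being near the
threshold is RARE. Planting a clique on `A` (`|A| = d = min k n`) switches on only the `≤ C(d,2)` slots inside `A`,
so for EVERY `A` the planted event lies in `{θ ≤ #on x} ∪ {#on x < θ ≤ #on x + C(d,2)}`, and the window has
`G(n,1/2)`-probability `≤ C(d,2) · max_j C(N,j)/2^N ≤ C(d,2)/√(N+1)` (`N = C(n,2)`; the modal probability of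
`Bin(N,1/2)` is `≤ 1/√(N+1)`, `BinomialTV.b_le_inv_sqrt`, i.e. `Nat.choose_le_middle` + the Wallis-type bound
`C(N,⌊N/2⌋)² (N+1) ≤ 4^N`). Finally `C(d,2)/√(N+1) ≤ d² · (2/n) ≤ 8 n^{-2δ}` as `d ≤ 2 n^{1/2-δ}`.

* `card_filter_plant_le_add_choose` — `#on (plant A x) ≤ #on x + C(|A|, 2)`;
* `card_window_le` — on the cube `α → Bool`: `#{x | #supp x < θ ≤ #supp x + w} ≤ 2^N · w/√(N+1)`;
* `erdosRenyiHalf_window_le` — the same under `G(n,1/2)`: `≤ w/√(C(n,2)+1)`;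
* `erdosRenyiHalf_plant_threshold_le` — per planted set: `Pr_x[θ ≤ #on (plant A x)] ≤ Pr_x[θ ≤ #on x] + C(|A|,2)/√(C(n,2)+1)`;
* `plantedCliqueDist_threshold_le` — averaged over `A ∈ kSubsets n k` (`plantedCliqueDist_toOuterMeasure_eq_sum`);
* `choose_div_sqrt_le` — the rate `C(d,2)/√(C(n,2)+1) ≤ 8 n^{-2δ}` (`n ≥ 1`);
* `stub_thresholdWeakBlind` — the registered stub, `ε n = 8 (n^{-δ})²`.

All `--supports stmt-PneNP-18027`; no definitions.
-/

set_option linter.dupNamespace false -- `Summit.PneNP.PneNP.…` is the layout-mandated namespace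

namespace Summit.PneNP.PneNP.Theorems.MonotoneBlind.VertexCover

open Literature.Computability.Complexity Literature.Probability.RandomGraphs.PlantedClique Filter Finset
open scoped ENNReal Topology Classical

/-! ### Planting moves the edge count by at most `C(|A|, 2)` -/

/-- **Planting switches on at most `C(|A|, 2)` slots**: `#on (plant A x) ≤ #on x + C(|A|, 2)` (a slot on after
planting was on before or is a `2`-subset of `A`, `card_filter_inside_le_choose`). [folklore] -/
theorem card_filter_plant_le_add_choose {n : ℕ} (A : Finset (Fin n)) (x : EdgeVec n) :
    #(univ.filter fun e : (⊤ : SimpleGraph (Fin n)).edgeSet => plant A x e = true) ≤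
      #(univ.filter fun e : (⊤ : SimpleGraph (Fin n)).edgeSet => x e = true) + (#A).choose 2 := by
  have hins : #(univ.filter fun e : (⊤ : SimpleGraph (Fin n)).edgeSet => ∀ v ∈ (e : Sym2 (Fin n)), v ∈ A) ≤
      (#A).choose 2 :=
    (card_filter_inside_le_choose A (univ : Finset (⊤ : SimpleGraph (Fin n)).edgeSet)).trans
      (Nat.choose_le_choose 2 (card_le_card inter_subset_left))
  calc #(univ.filter fun e : (⊤ : SimpleGraph (Fin n)).edgeSet => plant A x e = true)
      ≤ #((univ.filter fun e : (⊤ : SimpleGraph (Fin n)).edgeSet => x e = true) ∪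
          univ.filter fun e : (⊤ : SimpleGraph (Fin n)).edgeSet => ∀ v ∈ (e : Sym2 (Fin n)), v ∈ A) := by
        refine card_le_card fun e he => ?_
        rw [mem_filter, plant_apply_eq_true_iff] at he
        rw [mem_union, mem_filter, mem_filter]
        rcases he.2 with h | h
        · exact Or.inl ⟨mem_univ _, h⟩
        · exact Or.inr ⟨mem_univ _, h⟩
    _ ≤ #(univ.filter fun e : (⊤ : SimpleGraph (Fin n)).edgeSet => x e = true) +
          #(univ.filter fun e : (⊤ : SimpleGraph (Fin n)).edgeSet => ∀ v ∈ (e : Sym2 (Fin n)), v ∈ A) :=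
        card_union_le _ _
    _ ≤ _ := Nat.add_le_add_left hins _

/-! ### Anti-concentration of `Bin(N, 1/2)`: windows below a threshold are rare -/

section Window

variable {α : Type*} [Fintype α] [DecidableEq α]

/-- **Window count.** On the cube `α → Bool` (`N = |α|`) the vectors whose weight lies in the window
`#supp x < θ ≤ #supp x + w` number at most `2^N · w/√(N+1)`: fibre over the weight (at most `w` slices
`{#supp = j}`, `θ - w ≤ j < θ`, each of size `C(N, j)` by `card_slice_eq_choose`) and bound every slice by the modal
one, `C(N, j) ≤ 2^N/√(N+1)` (`BinomialTV.b_le_inv_sqrt`). [folklore] -/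
theorem card_window_le (θ w : ℕ) :
    (#((univ : Finset (α → Bool)).filter fun x =>
        #(univ.filter fun a => x a = true) < θ ∧ θ ≤ #(univ.filter fun a => x a = true) + w) : ℝ) ≤
      2 ^ Fintype.card α * ((w : ℝ) / Real.sqrt (Fintype.card α + 1)) := by
  obtain ⟨N, hN⟩ : ∃ N : ℕ, Fintype.card α = N := ⟨_, rfl⟩
  -- fibre over the weight
  have hcount : #((univ : Finset (α → Bool)).filter fun x =>
        #(univ.filter fun a => x a = true) < θ ∧ θ ≤ #(univ.filter fun a => x a = true) + w) ≤
      ∑ j ∈ Ico (θ - w) θ, N.choose j := by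
    calc #((univ : Finset (α → Bool)).filter fun x =>
          #(univ.filter fun a => x a = true) < θ ∧ θ ≤ #(univ.filter fun a => x a = true) + w)
        ≤ #((Ico (θ - w) θ).biUnion fun j =>
            (univ : Finset (α → Bool)).filter fun y => #(univ.filter fun a => y a = true) = j) := by
          refine card_le_card fun x hx => ?_
          rw [mem_filter] at hx
          obtain ⟨-, hlt, hle⟩ := hx
          exact mem_biUnion.2 ⟨#(univ.filter fun a => x a = true), mem_Ico.2 ⟨by omega, hlt⟩,
            mem_filter.2 ⟨mem_univ _, rfl⟩⟩
      _ ≤ ∑ j ∈ Ico (θ - w) θ,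
            #((univ : Finset (α → Bool)).filter fun y => #(univ.filter fun a => y a = true) = j) :=
          card_biUnion_le
      _ = ∑ j ∈ Ico (θ - w) θ, N.choose j :=
          sum_congr rfl fun j _ => by rw [MonotoneSuffices.SliceTransport.card_slice_eq_choose j, hN]
  -- every slice is at most the modal one, `≤ 2^N/√(N+1)`
  have hslice : ∀ j, (N.choose j : ℝ) ≤ 1 / Real.sqrt (N + 1) * 2 ^ N := fun j => by
    have h : (N.choose j : ℝ) / 2 ^ N ≤ 1 / Real.sqrt (N + 1) := BinomialTV.b_le_inv_sqrt N j
    rwa [div_le_iff₀ (by positivity)] at h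
  have hIco : #(Ico (θ - w) θ) ≤ w := by
    rw [Nat.card_Ico]
    omega
  rw [hN]
  calc (#((univ : Finset (α → Bool)).filter fun x =>
          #(univ.filter fun a => x a = true) < θ ∧ θ ≤ #(univ.filter fun a => x a = true) + w) : ℝ)
      ≤ ∑ j ∈ Ico (θ - w) θ, (N.choose j : ℝ) := by exact_mod_cast hcount
    _ ≤ ∑ j ∈ Ico (θ - w) θ, 1 / Real.sqrt (N + 1) * 2 ^ N := sum_le_sum fun j _ => hslice j
    _ = (#(Ico (θ - w) θ) : ℝ) * (1 / Real.sqrt (N + 1) * 2 ^ N) := by rw [sum_const, nsmul_eq_mul]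
    _ ≤ (w : ℝ) * (1 / Real.sqrt (N + 1) * 2 ^ N) :=
        mul_le_mul_of_nonneg_right (by exact_mod_cast hIco) (by positivity)
    _ = 2 ^ N * ((w : ℝ) / Real.sqrt (N + 1)) := by ring

end Window

/-- **Near-threshold edge counts are rare under `G(n,1/2)`**: `Pr[#on x < θ ≤ #on x + w] ≤ w/√(C(n,2)+1)`
(`card_window_le` on the `C(n,2)` edge slots, counting to probability by
`thresholdSharp_erdosRenyiHalf_le_ofReal`). [folklore] -/
theorem erdosRenyiHalf_window_le (n θ w : ℕ) :
    (erdosRenyiHalf n).toOuterMeasure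
        {x | #(univ.filter fun e : (⊤ : SimpleGraph (Fin n)).edgeSet => x e = true) < θ ∧
          θ ≤ #(univ.filter fun e : (⊤ : SimpleGraph (Fin n)).edgeSet => x e = true) + w} ≤
      ENNReal.ofReal ((w : ℝ) / Real.sqrt (n.choose 2 + 1)) := by
  refine MonotoneSuffices.DensityShift.thresholdSharp_erdosRenyiHalf_le_ofReal _ (by positivity) ?_
  have hE : Fintype.card ((⊤ : SimpleGraph (Fin n)).edgeSet) = n.choose 2 := by
    convert card_edgeSet_top_fin n
  have h := card_window_le (α := (⊤ : SimpleGraph (Fin n)).edgeSet) θ w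
  rw [hE] at h
  have hx : ((univ : Finset (EdgeVec n)).filter fun x => x ∈ {x : EdgeVec n |
      #(univ.filter fun e : (⊤ : SimpleGraph (Fin n)).edgeSet => x e = true) < θ ∧
        θ ≤ #(univ.filter fun e : (⊤ : SimpleGraph (Fin n)).edgeSet => x e = true) + w}) =
      (univ : Finset (EdgeVec n)).filter fun x =>
        #(univ.filter fun e : (⊤ : SimpleGraph (Fin n)).edgeSet => x e = true) < θ ∧
          θ ≤ #(univ.filter fun e : (⊤ : SimpleGraph (Fin n)).edgeSet => x e = true) + w := by
    ext x; simp
  rw [hx]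
  exact_mod_cast h

/-! ### Per planted set, and on average -/

/-- **Per planted set**: `Pr_x[θ ≤ #on (plant A x)] ≤ Pr_x[θ ≤ #on x] + C(|A|, 2)/√(C(n,2)+1)` — by
`card_filter_plant_le_add_choose` the planted event lies in `{θ ≤ #on x} ∪ {#on x < θ ≤ #on x + C(|A|,2)}`, and the
window is rare (`erdosRenyiHalf_window_le`). [folklore] -/
theorem erdosRenyiHalf_plant_threshold_le {n : ℕ} (A : Finset (Fin n)) (θ : ℕ) :
    (erdosRenyiHalf n).toOuterMeasure {x | plant A x ∈
        {x : EdgeVec n | θ ≤ #(univ.filter fun e : (⊤ : SimpleGraph (Fin n)).edgeSet => x e = true)}} ≤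
      (erdosRenyiHalf n).toOuterMeasure
          {x : EdgeVec n | θ ≤ #(univ.filter fun e : (⊤ : SimpleGraph (Fin n)).edgeSet => x e = true)} +
        ENNReal.ofReal ((((#A).choose 2 : ℕ) : ℝ) / Real.sqrt (n.choose 2 + 1)) := by
  have hsplit : {x | plant A x ∈
        {x : EdgeVec n | θ ≤ #(univ.filter fun e : (⊤ : SimpleGraph (Fin n)).edgeSet => x e = true)}} ⊆
      {x : EdgeVec n | θ ≤ #(univ.filter fun e : (⊤ : SimpleGraph (Fin n)).edgeSet => x e = true)} ∪
        {x | #(univ.filter fun e : (⊤ : SimpleGraph (Fin n)).edgeSet => x e = true) < θ ∧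
          θ ≤ #(univ.filter fun e : (⊤ : SimpleGraph (Fin n)).edgeSet => x e = true) + (#A).choose 2} := by
    intro x hx
    simp only [Set.mem_setOf_eq] at hx
    have hle := hx.trans (card_filter_plant_le_add_choose A x)
    by_cases hθ : θ ≤ #(univ.filter fun e : (⊤ : SimpleGraph (Fin n)).edgeSet => x e = true)
    · exact Or.inl hθ
    · exact Or.inr ⟨not_le.1 hθ, hle⟩
  calc (erdosRenyiHalf n).toOuterMeasure {x | plant A x ∈
          {x : EdgeVec n | θ ≤ #(univ.filter fun e : (⊤ : SimpleGraph (Fin n)).edgeSet => x e = true)}}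
      ≤ (erdosRenyiHalf n).toOuterMeasure
          ({x : EdgeVec n | θ ≤ #(univ.filter fun e : (⊤ : SimpleGraph (Fin n)).edgeSet => x e = true)} ∪
            {x | #(univ.filter fun e : (⊤ : SimpleGraph (Fin n)).edgeSet => x e = true) < θ ∧
              θ ≤ #(univ.filter fun e : (⊤ : SimpleGraph (Fin n)).edgeSet => x e = true) + (#A).choose 2}) :=
        (erdosRenyiHalf n).toOuterMeasure.mono hsplit
    _ ≤ (erdosRenyiHalf n).toOuterMeasure
            {x : EdgeVec n | θ ≤ #(univ.filter fun e : (⊤ : SimpleGraph (Fin n)).edgeSet => x e = true)} +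
          (erdosRenyiHalf n).toOuterMeasure
            {x | #(univ.filter fun e : (⊤ : SimpleGraph (Fin n)).edgeSet => x e = true) < θ ∧
              θ ≤ #(univ.filter fun e : (⊤ : SimpleGraph (Fin n)).edgeSet => x e = true) + (#A).choose 2} :=
        MeasureTheory.measure_union_le _ _
    _ ≤ _ := add_le_add le_rfl (erdosRenyiHalf_window_le n θ _)

/-- **Per `n`, averaged over the planted set**: for all `n k θ`,
`Pr_{G(n,1/2,k)}[θ ≤ #on] ≤ Pr_{G(n,1/2)}[θ ≤ #on] + C(d, 2)/√(C(n,2)+1)`, `d = min k n` (fibre the planted law over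
`A ∈ kSubsets n k`, `plantedCliqueDist_toOuterMeasure_eq_sum`, and apply `erdosRenyiHalf_plant_threshold_le` with
`|A| = d`). [folklore] -/
theorem plantedCliqueDist_threshold_le (n k θ : ℕ) :
    (plantedCliqueDist n k).toOuterMeasure
        {x | θ ≤ #(univ.filter fun e : (⊤ : SimpleGraph (Fin n)).edgeSet => x e = true)} ≤
      (erdosRenyiHalf n).toOuterMeasure
          {x | θ ≤ #(univ.filter fun e : (⊤ : SimpleGraph (Fin n)).edgeSet => x e = true)} +
        ENNReal.ofReal ((((min k n).choose 2 : ℕ) : ℝ) / Real.sqrt (n.choose 2 + 1)) := by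
  have hne := card_kSubsets_cast_ne_zero n k
  have htop : ((#(kSubsets n k) : ℕ) : ℝ≥0∞) ≠ ⊤ := ENNReal.natCast_ne_top _
  rw [plantedCliqueDist_toOuterMeasure_eq_sum]
  calc ((#(kSubsets n k) : ℕ) : ℝ≥0∞)⁻¹ * ∑ A ∈ kSubsets n k, (erdosRenyiHalf n).toOuterMeasure {x | plant A x ∈
          {x : EdgeVec n | θ ≤ #(univ.filter fun e : (⊤ : SimpleGraph (Fin n)).edgeSet => x e = true)}}
      ≤ ((#(kSubsets n k) : ℕ) : ℝ≥0∞)⁻¹ * ∑ A ∈ kSubsets n k,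
          ((erdosRenyiHalf n).toOuterMeasure
              {x : EdgeVec n | θ ≤ #(univ.filter fun e : (⊤ : SimpleGraph (Fin n)).edgeSet => x e = true)} +
            ENNReal.ofReal ((((min k n).choose 2 : ℕ) : ℝ) / Real.sqrt (n.choose 2 + 1))) := by
        gcongr with A hA
        rw [← card_of_mem_kSubsets hA]
        exact erdosRenyiHalf_plant_threshold_le A θ
    _ = (erdosRenyiHalf n).toOuterMeasure
            {x : EdgeVec n | θ ≤ #(univ.filter fun e : (⊤ : SimpleGraph (Fin n)).edgeSet => x e = true)} +
          ENNReal.ofReal ((((min k n).choose 2 : ℕ) : ℝ) / Real.sqrt (n.choose 2 + 1)) := by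
        rw [sum_const, nsmul_eq_mul, ← mul_assoc, ENNReal.inv_mul_cancel hne htop, one_mul]

/-! ### The rate and the stub -/

/-- **The rate**: `C(d, 2)/√(C(n,2)+1) ≤ 8 n^{-2δ}` for `d = min ⌈n^{1/2-δ}⌉ n` and `n ≥ 1`
(`d ≤ 2 n^{1/2-δ} = 2 √n · n^{-δ}` by `ceil_rpow_le_two_mul`, `C(d,2) ≤ d²`, `√(C(n,2)+1) ≥ n/2`). [folklore] -/
theorem choose_div_sqrt_le {δ : ℝ} (hδ' : δ < 1 / 2) {n : ℕ} (hn : 1 ≤ n) :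
    ((((min ⌈(n : ℝ) ^ (1 / 2 - δ)⌉₊ n).choose 2 : ℕ) : ℝ)) / Real.sqrt (n.choose 2 + 1) ≤
      8 * ((n : ℝ) ^ (-δ)) ^ 2 := by
  have hnpos : 0 < n := hn
  have hnR : (0 : ℝ) < n := by exact_mod_cast hnpos
  obtain ⟨d, hd⟩ : ∃ d : ℕ, min ⌈(n : ℝ) ^ (1 / 2 - δ)⌉₊ n = d := ⟨_, rfl⟩
  -- `d ≤ 2 √n · n^{-δ}`
  have hdle : (d : ℝ) ≤ 2 * ((n : ℝ) ^ (1 / 2 : ℝ) * (n : ℝ) ^ (-δ)) := by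
    have h1 : (d : ℝ) ≤ ⌈(n : ℝ) ^ (1 / 2 - δ)⌉₊ := by
      rw [← hd]
      exact_mod_cast min_le_left _ _
    rw [← rpow_half_sub_eq hnpos]
    exact h1.trans (ceil_rpow_le_two_mul hδ' hn)
  -- numerator `≤ d² ≤ 4 n (n^{-δ})²`
  have hnum : ((d.choose 2 : ℕ) : ℝ) ≤ 4 * n * ((n : ℝ) ^ (-δ)) ^ 2 := by
    have h1 : ((d.choose 2 : ℕ) : ℝ) ≤ (d : ℝ) ^ 2 := by exact_mod_cast Nat.choose_le_pow d 2
    have hsq : ((n : ℝ) ^ (1 / 2 : ℝ)) ^ 2 = n := by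
      rw [sq, ← Real.rpow_add hnR]
      norm_num
    calc ((d.choose 2 : ℕ) : ℝ) ≤ (d : ℝ) ^ 2 := h1
      _ ≤ (2 * ((n : ℝ) ^ (1 / 2 : ℝ) * (n : ℝ) ^ (-δ))) ^ 2 := by gcongr
      _ = 4 * ((n : ℝ) ^ (1 / 2 : ℝ)) ^ 2 * ((n : ℝ) ^ (-δ)) ^ 2 := by ring
      _ = 4 * n * ((n : ℝ) ^ (-δ)) ^ 2 := by rw [hsq]
  -- denominator `≥ n/2`
  have hden : (n : ℝ) / 2 ≤ Real.sqrt (n.choose 2 + 1) := by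
    refine Real.le_sqrt_of_sq_le ?_
    rw [Nat.cast_choose_two]
    nlinarith [sq_nonneg ((n : ℝ) - 1)]
  have hsqrt_pos : 0 < Real.sqrt (n.choose 2 + 1) := Real.sqrt_pos.2 (by positivity)
  rw [hd, div_le_iff₀ hsqrt_pos]
  calc ((d.choose 2 : ℕ) : ℝ) ≤ 4 * n * ((n : ℝ) ^ (-δ)) ^ 2 := hnum
    _ = 8 * ((n : ℝ) ^ (-δ)) ^ 2 * ((n : ℝ) / 2) := by ring
    _ ≤ 8 * ((n : ℝ) ^ (-δ)) ^ 2 * Real.sqrt (n.choose 2 + 1) := by gcongr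

/-- **`stub_thresholdWeakBlind`** (registered stub of stmt-PneNP-18027, line `Sketch`; edge-count thresholds are
weakly blind — calibration of barrier note B3). For `δ ∈ (0,1/2)` and ANY thresholds `θ n`, the monotone test
`[#{e | x e = true} ≥ θ n]` satisfies `Pr_planted ≤ Pr_null + ε n` eventually with `ε n → 0`. Proof: planting
switches on at most the `C(d,2)` slots inside `A`, so `Pr_planted[#on ≥ θ] ≤ Pr_null[#on ≥ θ] + Pr_null[θ - C(d,2) ≤
#on < θ] ≤ Pr_null[#on ≥ θ] + C(d,2) · max_j C(N,j)/2^N`, `max_j C(N,j)/2^N ≤ 1/√(N+1)` (`Nat.choose_le_middle` +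
`C(N,⌊N/2⌋)² (N+1) ≤ 4^N`), and `C(d,2)/√(N+1) ≤ 8 n^{-2δ} → 0` (`plantedCliqueDist_threshold_le`,
`choose_div_sqrt_le`, `ε n = 8 (n^{-δ})²`). [folklore] -/
theorem stub_thresholdWeakBlind :
    ∀ δ : ℝ, 0 < δ → δ < 1 / 2 → ∀ θ : ℕ → ℕ,
      ∃ ε : ℕ → ℝ≥0∞, Tendsto ε atTop (𝓝 0) ∧
        ∀ᶠ n : ℕ in atTop,
          (plantedCliqueDist n ⌈(n : ℝ) ^ (1 / 2 - δ)⌉₊).toOuterMeasure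
              {x | θ n ≤ #(univ.filter fun e : (⊤ : SimpleGraph (Fin n)).edgeSet => x e = true)} ≤
            (erdosRenyiHalf n).toOuterMeasure
              {x | θ n ≤ #(univ.filter fun e : (⊤ : SimpleGraph (Fin n)).edgeSet => x e = true)} + ε n := by
  intro δ hδ hδ' θ
  refine ⟨fun n => ENNReal.ofReal (8 * ((n : ℝ) ^ (-δ)) ^ 2), ?_, ?_⟩
  · -- `8 (n^{-δ})² → 0`
    have hneg : Tendsto (fun n : ℕ => (n : ℝ) ^ (-δ)) atTop (𝓝 0) :=
      (tendsto_rpow_neg_atTop hδ).comp tendsto_natCast_atTop_atTop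
    have h := ENNReal.tendsto_ofReal ((hneg.pow 2).const_mul 8)
    simpa using h
  · filter_upwards [eventually_ge_atTop 1] with n hn
    exact (plantedCliqueDist_threshold_le n _ (θ n)).trans
      (add_le_add le_rfl (ENNReal.ofReal_le_ofReal (choose_div_sqrt_le hδ' hn)))

end Summit.PneNP.PneNP.Theorems.MonotoneBlind.VertexCover
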